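import Summits.CriticalPhenomena.CardyFormulaZ2.Theorems.CardyIKTransportIKLinearTransportWallDominationHonThinRing

/-!
# `CardyIKTransport.IKLinearTransport` (stmt-CriticalPhenomena-5076), line `pinned-diagram-exchange`, lead c8 wave 2 —
# WALL DOMINATION: the site-`𝕋` thin ring through the wall WITH FREE MARGINS (`honThinRingChain_margin`)

Support file (`--supports stmt-CriticalPhenomena-5076`, registered sub-goal `honThinRingChain_margin`).  The geometry the
lead's planar transfer needs: on the ALL-HONEYCOMB slab of `s + s` face columns (wall column `s`) of the cylinder of
circumference `L = 2M + 7s + 1` — rows: bottom margin `[0, M)`, LOWER WINDOW `B = [M, M+s)`, core `[M+s, M+2s)`, UPPER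
WINDOW `A = [M+2s, M+3s)`, top margin `[M+3s, 2M+3s)`, off-band `[2M+3s, L)` — the chained thin-ring event
`thinRingChain s s A B` has probability `≥ c > 0` with `c` independent of `s ≥ 1` AND of the margin `M` (the margins are not
used by the construction).  Same route as `…WallDominationHonThinRing` (whose helpers `HonThinRingStub.*` are reused):
1. GLUING (`honCfg_mem_thinRingChain_gen`, the assembly of `HonThinRingStub.honCfg_mem_thinRingChain` with the wall column,
   the two window strips and the vertical box as parameters; `HonThinRingStub.wall_visits`, `leftRel_of_pathIn`,
   `rightRel_of_pathIn`): the crossings `H⁺` of `[0, 2s] × [M+2s, M+3s-1]`, `H⁻` of `[0, 2s] × [M, M+s-1]`, `V_L` of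
   `[0, s] × [M, M+3s-1]` and `V_R` of `[s, 2s] × [M, M+3s-1]` put `honCfg (s + s) L ω` in the event
   (`honCfg_mem_thinRingChain_margin`).
2. PROBABILITY: Harris–FKG three times (`prod_le_cylProb_margin`) and RSW on `𝕋` at aspect `≤ 4`
   (`exists_const_le_prod_margin`: `HoneycombStub.exists_rsw_const`, chaining `pow_mul_pow_le_triLRCrossingProb_of_le`,
   the one-row box of `s = 1` by `triLRCrossingProb_pos`; translation invariance of the crossing probabilities makes the
   constant independent of `M`).
No new definition; nothing of the tree is restated.
-/

noncomputable section

namespace Summit.CriticalPhenomena.CardyFormulaZ2.Theorems.IKLinearTransport.PinnedDiagramExchange.WallDomination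

open scoped BigOperators Classical
open MeasureTheory Finset
open Literature.Probability.Percolation Literature.Probability.LatticeModels
open Summit.CriticalPhenomena.CardyFormulaZ2.Cruxes.IKMixedBoxCrossing.DefectClosureExploration
open TriCylArcsProof HonThinRingStub

namespace HonThinRingMarginStub

variable {n L : ℕ}

/-! ## §1 Gluing with the windows and the vertical box as parameters -/

/-- **Gluing, general windows.**  On the slab of `n + n` face columns (wall column `n`) of the cylinder of circumference
`L`: a left–right crossing of the strip `[0, 2n] × [b_A, b_A+n-1]`, one of `[0, 2n] × [b_B, b_B+n-1]`, a bottom–top crossing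
of `[0, n] × [b₀, b₀+h]` and one of `[n, 2n] × [b₀, b₀+h]` by sites of `ω`, with both strips inside the rows `[b₀, b₀+h]`,
`0 ≤ b₀`, `b₀ + h < L`, and windows `A ⊇` rows of the first strip, `B ⊇` rows of the second, put `honCfg (n + n) L ω` in
`thinRingChain n n A B` (first/last wall visits `HonThinRingStub.wall_visits`, the vertical crossings cross both strips,
`PathIn.exists_slab_crossing`; `u ~ v` inside the right part and `u' ~ v'` inside the left part through the vertical
crossings, `rightRel_of_pathIn` / `leftRel_of_pathIn`). -/
theorem honCfg_mem_thinRingChain_gen [NeZero L] {ω : Set (Site 2)} {A B : Set (ZMod L)} {bA bB b₀ : ℤ} {h : ℕ}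
    (hb₀ : 0 ≤ b₀) (hA₀ : b₀ ≤ bA) (hB₀ : b₀ ≤ bB) (hA₁ : bA + ((n - 1 : ℕ) : ℤ) ≤ b₀ + h)
    (hB₁ : bB + ((n - 1 : ℕ) : ℤ) ≤ b₀ + h) (hL : b₀ + h < L)
    (hWA : ∀ z : Site 2, bA ≤ z 1 → z 1 ≤ bA + ((n - 1 : ℕ) : ℤ) → ((z 1 : ℤ) : ZMod L) ∈ A)
    (hWB : ∀ z : Site 2, bB ≤ z 1 → z 1 ≤ bB + ((n - 1 : ℕ) : ℤ) → ((z 1 : ℤ) : ZMod L) ∈ B)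
    (hH₁ : ω ∈ triHCross 0 bA (2 * n) (n - 1)) (hH₂ : ω ∈ triHCross 0 bB (2 * n) (n - 1))
    (hV₁ : ω ∈ triVCross 0 b₀ n h) (hV₂ : ω ∈ triVCross n b₀ n h) :
    honCfg (n + n) L ω ∈ thinRingChain n n A B := by
  obtain ⟨x₁, y₁, hx₁, hy₁, hP₁⟩ := hV₁
  obtain ⟨x₂, y₂, hx₂, hy₂, hP₂⟩ := hV₂
  obtain ⟨T₁, hT₁S, hP₁', hT₁all⟩ := hP₁.exists_support
  obtain ⟨T₂, hT₂S, hP₂', hT₂all⟩ := hP₂.exists_support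
  have bT₁ : ∀ z ∈ T₁, (0 ≤ z 0 ∧ z 0 ≤ n ∧ 0 ≤ z 1 ∧ z 1 < L) ∧ z ∈ ω := fun z hz => by
    obtain ⟨hz, hzω⟩ := hT₁S hz
    simp only [mem_triStrip] at hz
    exact ⟨⟨by omega, by omega, by omega, by omega⟩, hzω⟩
  have bT₂ : ∀ z ∈ T₂, ((n : ℤ) ≤ z 0 ∧ z 0 ≤ 2 * n ∧ 0 ≤ z 1 ∧ z 1 < L) ∧ z ∈ ω := fun z hz => by
    obtain ⟨hz, hzω⟩ := hT₂S hz
    simp only [mem_triStrip] at hz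
    exact ⟨⟨by omega, by omega, by omega, by omega⟩, hzω⟩
  -- wall visits of the two horizontal crossings (the vertical crossings cross both strips)
  obtain ⟨u', u, z₁, z₂, hu', hu, bu', bu, hchA, hz₁, hz₂, hp₁, hp₂⟩ :=
    wall_visits (L := L) (W := A) (b := bA) (by omega) (by omega) hWA hH₁
      bT₁ (hP₁'.exists_slab_crossing 1 (by omega) (by omega) (by omega))
      bT₂ (hP₂'.exists_slab_crossing 1 (by omega) (by omega) (by omega))
  obtain ⟨v', v, z₃, z₄, hv', hv, bv', bv, hchB, hz₃, hz₄, hp₃, hp₄⟩ :=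
    wall_visits (L := L) (W := B) (b := bB) (by omega) (by omega) hWB hH₂
      bT₁ (hP₁'.exists_slab_crossing 1 (by omega) (by omega) (by omega))
      bT₂ (hP₂'.exists_slab_crossing 1 (by omega) (by omega) (by omega))
  -- `u' ~ v'` inside the left part through the left vertical crossing, `u ~ v` inside the right part through the right one
  have hl : PathIn triGraph {z : Site 2 | (0 ≤ z 0 ∧ z 0 ≤ n ∧ 0 ≤ z 1 ∧ z 1 < L) ∧ z ∈ ω} u' v' :=
    (hp₁.trans (((hT₁all z₁ hz₁).symm.trans (hT₁all z₃ hz₃)).mono fun z hz => bT₁ z hz)).trans hp₃.symm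
  have hr : PathIn triGraph {z : Site 2 | ((n : ℤ) ≤ z 0 ∧ z 0 ≤ 2 * n ∧ 0 ≤ z 1 ∧ z 1 < L) ∧ z ∈ ω} u v :=
    (hp₂.trans (((hT₂all z₂ hz₂).symm.trans (hT₂all z₄ hz₄)).mono fun z hz => bT₂ z hz)).trans hp₄.symm
  exact ⟨_, hWA u bu.1 bu.2, _, hWA u' bu'.1 bu'.2, _, hWB v bv.1 bv.2, _, hWB v' bv'.1 bv'.2,
    rightRel_of_pathIn (fun z hz => hz) hr hu hv, leftRel_of_pathIn (fun z hz => hz) hl hu' hv', hchA, hchB⟩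

/-- **Gluing with free margins.**  Wall column `s`, circumference `2M + 7s + 1`, windows `A = [M+2s, M+3s)`, `B = [M, M+s)`:
the crossings `H⁺` of `[0, 2s] × [M+2s, M+3s-1]`, `H⁻` of `[0, 2s] × [M, M+s-1]`, `V_L` of `[0, s] × [M, M+3s-1]` and `V_R` of
`[s, 2s] × [M, M+3s-1]` give the chained thin ring (`honCfg_mem_thinRingChain_gen`; all rows used are `< M + 3s ≤ L`, so
the rows read in `ℤ/L` keep their representatives, `HonThinRingStub.val_row`). -/
theorem honCfg_mem_thinRingChain_margin {s : ℕ} (hs : 1 ≤ s) (M : ℕ) [NeZero (2 * M + 7 * s + 1)]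
    {ω : Set (Site 2)} (hH₁ : ω ∈ triHCross 0 ((M : ℤ) + 2 * s) (2 * s) (s - 1))
    (hH₂ : ω ∈ triHCross 0 M (2 * s) (s - 1)) (hV₁ : ω ∈ triVCross 0 M s (3 * s - 1))
    (hV₂ : ω ∈ triVCross s M s (3 * s - 1)) :
    honCfg (s + s) (2 * M + 7 * s + 1) ω ∈ thinRingChain s s
      {r : ZMod (2 * M + 7 * s + 1) | M + 2 * s ≤ r.val ∧ r.val < M + 3 * s}
      {r : ZMod (2 * M + 7 * s + 1) | M ≤ r.val ∧ r.val < M + s} := by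
  refine honCfg_mem_thinRingChain_gen (bA := (M : ℤ) + 2 * s) (bB := (M : ℤ)) (b₀ := (M : ℤ)) (h := 3 * s - 1)
    (by positivity) (by omega) le_rfl (by omega) (by omega) (by push_cast; omega)
    (fun z h1 h2 => ?_) (fun z h1 h2 => ?_) hH₁ hH₂ hV₁ hV₂
  · have := val_row (L := 2 * M + 7 * s + 1) (z := z) (by omega) (by push_cast; omega)
    simp only [Set.mem_setOf_eq]
    omega
  · have := val_row (L := 2 * M + 7 * s + 1) (z := z) (by omega) (by push_cast; omega)
    simp only [Set.mem_setOf_eq]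
    omega

/-! ## §2 Probability: Harris–FKG and RSW on `𝕋` -/

/-- **Harris.**  `P(H⁺) P(H⁻) (P(V_L) P(V_R))` is at most the all-honeycomb slab probability of the chained thin-ring event
with free margins (`sitePercolation_harris'` three times, the slab law is the fair colouring `cylProb_hon_eq`, and the
gluing `honCfg_mem_thinRingChain_margin`). -/
theorem prod_le_cylProb_margin {s : ℕ} (hs : 1 ≤ s) (M : ℕ) [NeZero (2 * M + 7 * s + 1)] :
    (sitePercolation (Site 2) half).real (triHCross 0 ((M : ℤ) + 2 * s) (2 * s) (s - 1)) *
        (sitePercolation (Site 2) half).real (triHCross 0 M (2 * s) (s - 1)) *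
        ((sitePercolation (Site 2) half).real (triVCross 0 M s (3 * s - 1)) *
          (sitePercolation (Site 2) half).real (triVCross s M s (3 * s - 1))) ≤
      cylProb (s + s) (2 * M + 7 * s + 1) (fun _ => false) (thinRingChain s s
        {r : ZMod (2 * M + 7 * s + 1) | M + 2 * s ≤ r.val ∧ r.val < M + 3 * s}
        {r : ZMod (2 * M + 7 * s + 1) | M ≤ r.val ∧ r.val < M + s}) := by
  rw [cylProb_hon_eq]
  have d1 := determinedBy_triHCross 0 ((M : ℤ) + 2 * s) (2 * s) (s - 1)
  have d2 := determinedBy_triHCross 0 M (2 * s) (s - 1)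
  have d3 := determinedBy_triVCross 0 M s (3 * s - 1)
  have d4 := determinedBy_triVCross s M s (3 * s - 1)
  have u1 := isUpperSet_triHCross 0 ((M : ℤ) + 2 * s) (2 * s) (s - 1)
  have u2 := isUpperSet_triHCross 0 M (2 * s) (s - 1)
  have u3 := isUpperSet_triVCross 0 M s (3 * s - 1)
  have u4 := isUpperSet_triVCross s M s (3 * s - 1)
  have d12 : DeterminedBy (triHCross 0 ((M : ℤ) + 2 * s) (2 * s) (s - 1) ∩ triHCross 0 M (2 * s) (s - 1))
      ↑(triStripFinset 0 ((M : ℤ) + 2 * s) (2 * s) (s - 1) ∪ triStripFinset 0 M (2 * s) (s - 1)) :=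
    (d1.mono (by simp)).inter (d2.mono (by simp))
  have d34 : DeterminedBy (triVCross 0 M s (3 * s - 1) ∩ triVCross s M s (3 * s - 1))
      ↑(triStripFinset 0 M s (3 * s - 1) ∪ triStripFinset s M s (3 * s - 1)) :=
    (d3.mono (by simp)).inter (d4.mono (by simp))
  have h12 := sitePercolation_harris' half d1 d2 u1 u2
  have h34 := sitePercolation_harris' half d3 d4 u3 u4
  have h1234 := sitePercolation_harris' half d12 d34 (u1.inter u2) (u3.inter u4)
  refine ((mul_le_mul h12 h34 (mul_nonneg measureReal_nonneg measureReal_nonneg) measureReal_nonneg).trans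
    h1234).trans (measureReal_mono ?_ (measure_ne_top _ _))
  rintro ω ⟨⟨h1, h2⟩, h3, h4⟩
  exact honCfg_mem_thinRingChain_margin hs M h1 h2 h3 h4

/-- **RSW input.**  A constant `c > 0`, independent of `s ≥ 1` and of `M`, below `P(H⁺) P(H⁻) (P(V_L) P(V_R))`: the four are
long-way crossings of aspect `≤ 4` (`(2s+1) × s` and `3s × (s+1)` boxes; chaining `pow_mul_pow_le_triLRCrossingProb_of_le` with
`j = 3` from `exists_rsw_const` and width antitonicity, for `s ≥ 2` resp. `s ≥ 1`; the one-row horizontal box of `s = 1` by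
`triLRCrossingProb_pos`); their probabilities do not depend on the position (`triSitePercolation_real_triHCross/VCross`). -/
theorem exists_const_le_prod_margin : ∃ c : ℝ, 0 < c ∧ ∀ s M : ℕ, 1 ≤ s →
    c ≤ (sitePercolation (Site 2) half).real (triHCross 0 ((M : ℤ) + 2 * s) (2 * s) (s - 1)) *
        (sitePercolation (Site 2) half).real (triHCross 0 M (2 * s) (s - 1)) *
        ((sitePercolation (Site 2) half).real (triVCross 0 M s (3 * s - 1)) *
          (sitePercolation (Site 2) half).real (triVCross s M s (3 * s - 1))) := by
  obtain ⟨c₀, hc₀, hk⟩ :=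
    Summit.CriticalPhenomena.CardyFormulaZ2.Cruxes.IKMixedBoxCrossing.PairedMirrorExploration.HoneycombStub.exists_rsw_const
  have hhalf : 0 < ((half : unitInterval) : ℝ) := by simp [half]
  -- long-way crossings of aspect `≤ 4` by chaining
  have hlong : ∀ h w : ℕ, 1 ≤ h → w ≤ 4 * h → c₀ ^ 3 * c₀ ^ 2 ≤ triLRCrossingProb half w h := fun h w hh hw => by
    have h₁ : c₀ ≤ triLRCrossingProb half (2 * h) h := (hk h).trans (triLRCrossingProb_anti_width half (by omega) _)
    have h₂ : c₀ ≤ triLRCrossingProb half h h := (hk h).trans (triLRCrossingProb_anti_width half (by omega) _)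
    have := pow_mul_pow_le_triLRCrossingProb_of_le half h hc₀.le hc₀.le h₁ h₂ (j := 3) (by norm_num) (w := w)
      (by omega)
    simpa using this
  set cH : ℝ := min (c₀ ^ 3 * c₀ ^ 2) (triLRCrossingProb half 2 0) with hcH
  have hc₁pos : 0 < c₀ ^ 3 * c₀ ^ 2 := by positivity
  have hcHpos : 0 < cH := lt_min hc₁pos (triLRCrossingProb_pos hhalf 2 0)
  refine ⟨cH * cH * (c₀ ^ 3 * c₀ ^ 2 * (c₀ ^ 3 * c₀ ^ 2)), by positivity, fun s M hs => ?_⟩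
  have eH : ∀ b : ℤ, (sitePercolation (Site 2) half).real (triHCross 0 b (2 * s) (s - 1)) =
      triLRCrossingProb half (2 * s) (s - 1) := fun b => triSitePercolation_real_triHCross half 0 b _ _
  have eV : ∀ a b : ℤ, (sitePercolation (Site 2) half).real (triVCross a b s (3 * s - 1)) =
      triLRCrossingProb half (3 * s - 1) s := fun a b => triSitePercolation_real_triVCross half a b _ _
  rw [eH, eH, eV, eV]
  have hH : cH ≤ triLRCrossingProb half (2 * s) (s - 1) := by
    rcases Nat.lt_or_ge s 2 with h2 | h2
    · interval_cases s
      exact min_le_right _ _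
    · exact (min_le_left _ _).trans (hlong (s - 1) (2 * s) (by omega) (by omega))
  have hV : c₀ ^ 3 * c₀ ^ 2 ≤ triLRCrossingProb half (3 * s - 1) s := hlong s (3 * s - 1) hs (by omega)
  have h0 : 0 ≤ triLRCrossingProb half (2 * s) (s - 1) := measureReal_nonneg
  have h0' : 0 ≤ triLRCrossingProb half (3 * s - 1) s := measureReal_nonneg
  calc cH * cH * (c₀ ^ 3 * c₀ ^ 2 * (c₀ ^ 3 * c₀ ^ 2))
        ≤ triLRCrossingProb half (2 * s) (s - 1) * triLRCrossingProb half (2 * s) (s - 1) *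
          (triLRCrossingProb half (3 * s - 1) s * triLRCrossingProb half (3 * s - 1) s) :=
        mul_le_mul (mul_le_mul hH hH hcHpos.le h0) (mul_le_mul hV hV hc₁pos.le h0') (by positivity)
          (mul_nonneg h0 h0)
    _ = _ := by ring

end HonThinRingMarginStub

open HonThinRingMarginStub in
/-- **`honThinRingChain_margin` · THE SITE-`𝕋` THIN RING THROUGH THE WALL WITH FREE MARGINS.**  On the all-honeycomb slab of
`s + s` face columns of the cylinder of circumference `2M + 7s + 1` (site percolation on `𝕋` drawn on `[0, 2s] × [0, L)`), the
chained thin-ring event through the wall column `s` with upper window `[M+2s, M+3s)` and lower window `[M, M+s)` has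
probability `≥ c > 0` with `c` independent of `s ≥ 1` and of the margin `M`: Harris–FKG for the left–right crossings of
`[0, 2s] × [M+2s, M+3s)`, `[0, 2s] × [M, M+s)` and the bottom–top crossings of `[0, s] × [M, M+3s)`, `[s, 2s] × [M, M+3s)`,
RSW on `𝕋` at aspect `≤ 4`, and the gluing `honCfg_mem_thinRingChain_margin`. -/
theorem honThinRingChain_margin : ∃ c : ℝ, 0 < c ∧ ∀ (s M : ℕ), 1 ≤ s → ∀ (L : ℕ) [NeZero L],
    L = 2 * M + 7 * s + 1 → c ≤ cylProb (s + s) L (fun _ => false) (thinRingChain s s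
      {r : ZMod L | M + 2 * s ≤ r.val ∧ r.val < M + 3 * s} {r : ZMod L | M ≤ r.val ∧ r.val < M + s}) := by
  obtain ⟨c, hc, h⟩ := exists_const_le_prod_margin
  refine ⟨c, hc, fun s M hs L _ hL => ?_⟩
  subst hL
  exact (h s M hs).trans (prod_le_cylProb_margin hs M)

end Summit.CriticalPhenomena.CardyFormulaZ2.Theorems.IKLinearTransport.PinnedDiagramExchange.WallDomination

end
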